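import Literature.AlgebraicGeometry.ShimuraVarieties.UnitaryAuxiliarySpecialPairCMStructure
import Literature.AlgebraicGeometry.ShimuraVarieties.UnitaryAuxiliarySpecialPairRecipMatrix
import HarnessLib

/-!
# `J_{β,Φ}(x)` lies in the real span of the CM action of an orthogonal frame

[Deligne1971TravauxShimura] 4.18 («`h` se factorise par `T_ℝ`, `T = Res F^×`») / [Deligne1979ShimuraVarieties] Prop. 2.3.10:
continuation of ★ `UnitaryAuxiliarySpecialPairCMStructure` (the CM structure `c` of an `M`-frame `P` of `W₀ ⊕ V_M`, pinned by
`c.act x (β(m·P e_p)) = β((x_p m)·P e_p)`).  We read the action in matrices — `actMatrix c x = P_β·Res_{M/ℚ}(P·diag(x)·P⁻¹)·Q_β`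
(`actMatrix_eq_of_frame_spec`, restriction of scalars ★ `resMatrix`, base change ★ `resMatrix_map_includeRight`) — and prove the
KEY IDENTITY `auxComplexStructure_eq_sum_actMatrix`: whenever Deligne's block matrix `A = diag(iPhi, iPhi·s_x)` of `h_W(i)`
is diagonal in the frame, `A·P_ℝ = P_ℝ·diag(u)` (`u ∈ (ℝ ⊗_ℚ M)^{1⊕3} = F ⊗ ℝ`), the complex structure
`J = J_{β,Φ}(x)` (★ `auxComplexStructure`) is the real combination `Σ_{p,k} u_{p,k}·actMatrix c (e_p b_k)` of the CM action
(`u_p = Σ_k u_{p,k}(1 ⊗ b_k)` in the `ℚ`-basis `b = ratBasis M`).  Consequences: `J` commutes with the action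
(`auxComplexStructure_mul_actMatrix_comm`), and on a simultaneous eigenvector of the `i`-th factor with eigencharacter `ρ`
the complexified `J` is the scalar `Σ_k u_{i,k} ρ(b_k)` (`auxComplexStructure_map_mulVec_eq`), which is `realEmb ρ (u_i)` for
`ρ ∈ Φ` and `conj (realEmb ρ̄ (u_i))` for `ρ ∉ Φ` (`sum_repr_mul_eq_realEmb`, `sum_repr_mul_eq_conj_realEmb`).  The special
pair of a line (`IsSpecial`) is assembled from these in the sibling `UnitaryAuxiliarySpecialPair`.
-/

noncomputable section

open Matrix NumberField
open scoped TensorProduct ComplexConjugate Classical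

namespace Literature.AlgebraicGeometry.ShimuraVarieties.UnitaryCanonicalModel.Aux

open Literature.AlgebraicGeometry.ModuliOfAbelianVarieties
open Literature.Geometry.ComplexHyperbolic

section SpecRead

variable {L : Type} [Field L] {M : Type} [Field M] [NumberField M] [IsCMField M] {j : L →+* M}
  {H : Matrix (Fin 3) (Fin 3) L} {ξ₀ ξ : M} {g : ℕ} {δ : Fin g → ℕ}

/-- **Reading the action off the frame.** A CM structure `c` whose action is pinned on the frame vectors
(`c.act x (β(m·P e_p)) = β((x_p m)·P e_p)`, the spec of ★ `exists_cmStructure_of_orthogonal`) acts through `β` by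
`P·diag(x)·P⁻¹` on all of `M^{1⊕3}` (the frame vectors `M`-span it). [cite: Deligne1971TravauxShimura, 4.18 p. 150] -/
theorem act_apply_eq_of_frame_spec (F : SymplecticFrame M j H ξ₀ ξ g δ) (P : GL (Fin 1 ⊕ Fin 3) M)
    (c : CMStructure g δ (Fin 1 ⊕ Fin 3) (fun _ => M))
    (hc : ∀ (x : Fin 1 ⊕ Fin 3 → M) (p : Fin 1 ⊕ Fin 3) (m : M),
      c.act x (F.β (m • P.val *ᵥ Pi.single p 1)) = F.β ((x p * m) • P.val *ᵥ Pi.single p 1))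
    (x : Fin 1 ⊕ Fin 3 → M) (w : (Fin 1 ⊕ Fin 3) → M) :
    c.act x (F.β w) = F.β ((P.val * Matrix.diagonal x * (P⁻¹).val) *ᵥ w) := by
  have hw : w = ∑ p, ((P⁻¹).val *ᵥ w) p • P.val *ᵥ Pi.single p (1 : M) := by
    calc w = P.val *ᵥ ((P⁻¹).val *ᵥ w) := by rw [Matrix.mulVec_mulVec, Units.mul_inv, Matrix.one_mulVec]
      _ = P.val *ᵥ ∑ p, Pi.single p (((P⁻¹).val *ᵥ w) p) := by rw [Finset.univ_sum_single]
      _ = ∑ p, ((P⁻¹).val *ᵥ w) p • P.val *ᵥ Pi.single p (1 : M) := by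
          rw [Matrix.mulVec_sum]
          refine Finset.sum_congr rfl fun p _ => ?_
          rw [← Matrix.mulVec_smul, ← Pi.single_smul', smul_eq_mul, mul_one]
  conv_lhs => rw [hw]
  conv_rhs => rw [hw]
  rw [map_sum, map_sum, Matrix.mulVec_sum, map_sum]
  refine Finset.sum_congr rfl fun p _ => ?_
  have h := frameDiag_mulVecLin_apply_frameVec P x p (((P⁻¹).val *ᵥ w) p)
  rw [Matrix.mulVecLin_apply] at h
  rw [hc, h]

/-- **The matrix of the action in the frame**: `actMatrix c x = P_β · Res_{M/ℚ}(P·diag(x)·P⁻¹) · Q_β` (★ `frameP`, `frameQ`,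
restriction of scalars ★ `resMatrix` along the `ℚ`-basis `ratBasis M`). [cite: Deligne1971TravauxShimura, 4.9 p. 148 and 4.18 p. 150] -/
theorem actMatrix_eq_of_frame_spec (F : SymplecticFrame M j H ξ₀ ξ g δ) (P : GL (Fin 1 ⊕ Fin 3) M)
    (c : CMStructure g δ (Fin 1 ⊕ Fin 3) (fun _ => M))
    (hc : ∀ (x : Fin 1 ⊕ Fin 3 → M) (p : Fin 1 ⊕ Fin 3) (m : M),
      c.act x (F.β (m • P.val *ᵥ Pi.single p 1)) = F.β ((x p * m) • P.val *ᵥ Pi.single p 1))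
    (x : Fin 1 ⊕ Fin 3 → M) :
    c.actMatrix x = frameP F * resMatrix (ratBasis M) (P.val * Matrix.diagonal x * (P⁻¹).val) * frameQ F := by
  classical
  have hact : c.act x = F.β.toLinearMap ∘ₗ
      ((Matrix.mulVecLin (P.val * Matrix.diagonal x * (P⁻¹).val)).restrictScalars ℚ ∘ₗ F.β.symm.toLinearMap) := by
    refine LinearMap.ext fun v => ?_
    obtain ⟨w, rfl⟩ := F.β.surjective v
    rw [act_apply_eq_of_frame_spec F P c hc x w, LinearMap.comp_apply, LinearMap.comp_apply,
      LinearEquiv.coe_toLinearMap, LinearEquiv.coe_toLinearMap, LinearEquiv.symm_apply_apply,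
      LinearMap.restrictScalars_apply, Matrix.mulVecLin_apply]
  rw [CMStructure.actMatrix_def, hact, ← LinearMap.toMatrix_eq_toMatrix',
    LinearMap.toMatrix_comp (Pi.basisFun ℚ (Fin g ⊕ Fin g)) (resBasis (m := Fin 1 ⊕ Fin 3) (ratBasis M))
      (Pi.basisFun ℚ (Fin g ⊕ Fin g)),
    LinearMap.toMatrix_comp (Pi.basisFun ℚ (Fin g ⊕ Fin g)) (resBasis (m := Fin 1 ⊕ Fin 3) (ratBasis M))
      (resBasis (m := Fin 1 ⊕ Fin 3) (ratBasis M)),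
    toMatrix_resBasis_mulVecLin]
  simp only [Matrix.mul_assoc]
  rfl

/-- The action matrix base-changed to `R`: `actMatrix c x ⊗ R = P_R · Res_{R⊗M/R}((P·diag(x)·P⁻¹) ⊗ 1) · Q_R`.
[cite: Deligne1971TravauxShimura, 4.9 p. 148 and 4.18 p. 150] -/
theorem actMatrix_map_eq_of_frame_spec (R : Type) [CommRing R] [Algebra ℚ R] (F : SymplecticFrame M j H ξ₀ ξ g δ)
    (P : GL (Fin 1 ⊕ Fin 3) M) (c : CMStructure g δ (Fin 1 ⊕ Fin 3) (fun _ => M))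
    (hc : ∀ (x : Fin 1 ⊕ Fin 3 → M) (p : Fin 1 ⊕ Fin 3) (m : M),
      c.act x (F.β (m • P.val *ᵥ Pi.single p 1)) = F.β ((x p * m) • P.val *ᵥ Pi.single p 1))
    (x : Fin 1 ⊕ Fin 3 → M) :
    (c.actMatrix x).map (algebraMap ℚ R) =
      framePR R F * resMatrix (Algebra.TensorProduct.basis R (ratBasis M))
        ((P.val * Matrix.diagonal x * (P⁻¹).val).map (Algebra.TensorProduct.includeRight : M →ₐ[ℚ] R ⊗[ℚ] M)) *
        frameQR R F := by
  rw [actMatrix_eq_of_frame_spec F P c hc, Matrix.map_mul, Matrix.map_mul, resMatrix_map_includeRight]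
  rfl

/-- `J_{β,Φ}(x)` as a matrix: `P_ℝ · Res(diag(iPhi, iPhi·s_x)) · Q_ℝ`. [cite: Deligne1979ShimuraVarieties, Prop. 2.3.10 (PDF p. 32)] -/
theorem auxComplexStructure_eq_frame (F : SymplecticFrame M j H ξ₀ ξ g δ) (τ : L →+* ℂ)
    (Φ : Literature.AlgebraicGeometry.Motives.CMType M) (T : GL (Fin 3) ℂ) (x : BallModel.Ball) :
    auxComplexStructure F τ Φ T x =
      framePR ℝ F * resMatrix (Algebra.TensorProduct.basis ℝ (ratBasis M))
        ((blockGL (ℝ ⊗[ℚ] M) (iPhi M Φ, sPhi M j Φ τ T x) : GL (Fin 1 ⊕ Fin 3) (ℝ ⊗[ℚ] M)) :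
          Matrix (Fin 1 ⊕ Fin 3) (Fin 1 ⊕ Fin 3) (ℝ ⊗[ℚ] M)) * frameQR ℝ F := by
  rw [auxComplexStructure_def, auxRep, MonoidHom.comp_apply, MonoidHom.comp_apply, coe_conjRect, coe_resGL]

/-- `diagonal` is additive over finite sums. [cite: Deligne1971TravauxShimura, 4.18 p. 150] -/
private theorem diagonal_sum' {n κ α : Type} [Fintype κ] [DecidableEq n] [AddCommMonoid α] (f : κ → n → α) :
    Matrix.diagonal (∑ k, f k) = ∑ k, Matrix.diagonal (f k) :=
  map_sum (Matrix.diagonalAddMonoidHom n α) f Finset.univ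

/-- `Pi.single p` is additive over finite sums. [cite: Deligne1971TravauxShimura, 4.18 p. 150] -/
private theorem single_sum' {n κ α : Type} [Fintype κ] [DecidableEq n] [AddCommMonoid α] (p : n) (f : κ → α) :
    (Pi.single p (∑ k, f k) : n → α) = ∑ k, (Pi.single p (f k) : n → α) :=
  map_sum (AddMonoidHom.single (fun _ : n => α) p) f Finset.univ

omit [IsCMField M] in
/-- A block-diagonal-in-the-frame matrix is a combination of the frame projectors: if `A·P_ℝ = P_ℝ·diag(u)` then
`A = Σ_{p,k} u_{p,k} · (P·diag(e_p b_k)·P⁻¹) ⊗ 1`, `u_p = Σ_k u_{p,k} (1 ⊗ b_k)`. [cite: Deligne1971TravauxShimura, 4.18 p. 150] -/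
theorem eq_sum_smul_frameDiag_of_mul_eq (P : GL (Fin 1 ⊕ Fin 3) M)
    (A : Matrix (Fin 1 ⊕ Fin 3) (Fin 1 ⊕ Fin 3) (ℝ ⊗[ℚ] M)) (u : Fin 1 ⊕ Fin 3 → ℝ ⊗[ℚ] M)
    (hu : A * P.val.map (Algebra.TensorProduct.includeRight : M →ₐ[ℚ] ℝ ⊗[ℚ] M) =
      P.val.map (Algebra.TensorProduct.includeRight : M →ₐ[ℚ] ℝ ⊗[ℚ] M) * Matrix.diagonal u) :
    A = ∑ p : Fin 1 ⊕ Fin 3, ∑ k : Fin (Module.finrank ℚ M),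
      (Algebra.TensorProduct.basis ℝ (ratBasis M)).repr (u p) k •
        (P.val * Matrix.diagonal (Pi.single p (ratBasis M k)) * (P⁻¹).val).map
          (Algebra.TensorProduct.includeRight : M →ₐ[ℚ] ℝ ⊗[ℚ] M) := by
  set ι : M →ₐ[ℚ] ℝ ⊗[ℚ] M := Algebra.TensorProduct.includeRight with hι
  set bR := Algebra.TensorProduct.basis ℝ (ratBasis M) with hbR
  have hPPinv : P.val.map ι * (P⁻¹).val.map ι = 1 := by
    rw [← Matrix.map_mul, Units.mul_inv, Matrix.map_one ι (map_zero ι) (map_one ι)]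
  -- the diagonal as the combination of the elementary diagonals
  have hdiag : Matrix.diagonal u = ∑ p : Fin 1 ⊕ Fin 3, ∑ k : Fin (Module.finrank ℚ M),
      bR.repr (u p) k • Matrix.diagonal (Pi.single p (ι (ratBasis M k))) := by
    have h1 : ∀ p : Fin 1 ⊕ Fin 3, ∑ k : Fin (Module.finrank ℚ M),
        bR.repr (u p) k • Matrix.diagonal (Pi.single p (ι (ratBasis M k))) =
          Matrix.diagonal (Pi.single p (u p)) := by
      intro p
      have h2 : ∀ k, bR.repr (u p) k • Matrix.diagonal (Pi.single p (ι (ratBasis M k))) =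
          Matrix.diagonal (Pi.single p (bR.repr (u p) k • bR k)) := by
        intro k
        rw [← Matrix.diagonal_smul, ← Pi.single_smul', hbR, Algebra.TensorProduct.basis_apply, hι,
          Algebra.TensorProduct.includeRight_apply]
      simp_rw [h2]
      rw [← diagonal_sum', ← single_sum', bR.sum_repr (u p)]
    simp_rw [h1]
    rw [← diagonal_sum', Finset.univ_sum_single]
  -- `A = P_ι · diag(u) · P⁻¹_ι`
  have hA : A = P.val.map ι * Matrix.diagonal u * (P⁻¹).val.map ι := by
    calc A = A * (P.val.map ι * (P⁻¹).val.map ι) := by rw [hPPinv, Matrix.mul_one]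
      _ = P.val.map ι * Matrix.diagonal u * (P⁻¹).val.map ι := by rw [← Matrix.mul_assoc, hu]
  rw [hA, hdiag, Finset.mul_sum, Finset.sum_mul]
  refine Finset.sum_congr rfl fun p _ => ?_
  rw [Finset.mul_sum, Finset.sum_mul]
  refine Finset.sum_congr rfl fun k _ => ?_
  have hs : (fun q : Fin 1 ⊕ Fin 3 => ι ((Pi.single p (ratBasis M k) : Fin 1 ⊕ Fin 3 → M) q)) =
      Pi.single p (ι (ratBasis M k)) := by
    funext q
    by_cases h : q = p
    · subst h; simp
    · simp [Pi.single_eq_of_ne h]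
  rw [Matrix.mul_smul, Matrix.smul_mul, Matrix.map_mul, Matrix.map_mul, Matrix.diagonal_map (map_zero ι), hs]

/-- **KEY IDENTITY: `J_{β,Φ}(x)` lies in the real span of the CM action.** If `diag(iPhi, iPhi·s_x)·P_ℝ = P_ℝ·diag(u)` for the
frame `P` pinning the CM structure `c` (★ `blockGL_iPhi_sPhi_mul_frame_eq` for `P = diag(1, B)`), then
`J = Σ_{p,k} u_{p,k} · act(e_p b_k) ⊗ ℝ` with `u_p = Σ_k u_{p,k}(1 ⊗ b_k)`: the complex structure is the image of
`u ∈ F ⊗ ℝ = (ℝ ⊗_ℚ M)^{1⊕3}` under the CM action — Deligne's «`h` se factorise par `T_ℝ ⊂ G_ℝ`», `T = Res F^×`.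
[cite: Deligne1971TravauxShimura, 4.18 p. 150] [cite: Deligne1979ShimuraVarieties, Prop. 2.3.10 (PDF p. 32)] -/
theorem auxComplexStructure_eq_sum_actMatrix (F : SymplecticFrame M j H ξ₀ ξ g δ) (τ : L →+* ℂ)
    (Φ : Literature.AlgebraicGeometry.Motives.CMType M) (T : GL (Fin 3) ℂ) (x : BallModel.Ball)
    (P : GL (Fin 1 ⊕ Fin 3) M) (c : CMStructure g δ (Fin 1 ⊕ Fin 3) (fun _ => M))
    (hc : ∀ (y : Fin 1 ⊕ Fin 3 → M) (p : Fin 1 ⊕ Fin 3) (m : M),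
      c.act y (F.β (m • P.val *ᵥ Pi.single p 1)) = F.β ((y p * m) • P.val *ᵥ Pi.single p 1))
    (u : Fin 1 ⊕ Fin 3 → ℝ ⊗[ℚ] M)
    (hu : ((blockGL (ℝ ⊗[ℚ] M) (iPhi M Φ, sPhi M j Φ τ T x) : GL (Fin 1 ⊕ Fin 3) (ℝ ⊗[ℚ] M)) :
          Matrix (Fin 1 ⊕ Fin 3) (Fin 1 ⊕ Fin 3) (ℝ ⊗[ℚ] M)) *
        P.val.map (Algebra.TensorProduct.includeRight : M →ₐ[ℚ] ℝ ⊗[ℚ] M) =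
      P.val.map (Algebra.TensorProduct.includeRight : M →ₐ[ℚ] ℝ ⊗[ℚ] M) * Matrix.diagonal u) :
    auxComplexStructure F τ Φ T x = ∑ p : Fin 1 ⊕ Fin 3, ∑ k : Fin (Module.finrank ℚ M),
      (Algebra.TensorProduct.basis ℝ (ratBasis M)).repr (u p) k •
        (c.actMatrix (Pi.single p (ratBasis M k))).map (algebraMap ℚ ℝ) := by
  rw [auxComplexStructure_eq_frame, eq_sum_smul_frameDiag_of_mul_eq P _ u hu, map_sum, Matrix.mul_sum,
    Matrix.sum_mul]
  refine Finset.sum_congr rfl fun p _ => ?_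
  rw [map_sum, Matrix.mul_sum, Matrix.sum_mul]
  refine Finset.sum_congr rfl fun k _ => ?_
  rw [resMatrix_smul, Matrix.mul_smul, Matrix.smul_mul, actMatrix_map_eq_of_frame_spec ℝ F P c hc]

/-! ### `IsSpecial`: commutation and eigencharacters -/

/-- **`J` commutes with the CM action** (it lies in its real span, ★ `auxComplexStructure_eq_sum_actMatrix`, and `F` is
commutative). [cite: Deligne1971TravauxShimura, 4.18 p. 150] -/
theorem auxComplexStructure_mul_actMatrix_comm (F : SymplecticFrame M j H ξ₀ ξ g δ) (τ : L →+* ℂ)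
    (Φ : Literature.AlgebraicGeometry.Motives.CMType M) (T : GL (Fin 3) ℂ) (x : BallModel.Ball)
    (P : GL (Fin 1 ⊕ Fin 3) M) (c : CMStructure g δ (Fin 1 ⊕ Fin 3) (fun _ => M))
    (hc : ∀ (y : Fin 1 ⊕ Fin 3 → M) (p : Fin 1 ⊕ Fin 3) (m : M),
      c.act y (F.β (m • P.val *ᵥ Pi.single p 1)) = F.β ((y p * m) • P.val *ᵥ Pi.single p 1))
    (u : Fin 1 ⊕ Fin 3 → ℝ ⊗[ℚ] M)
    (hu : ((blockGL (ℝ ⊗[ℚ] M) (iPhi M Φ, sPhi M j Φ τ T x) : GL (Fin 1 ⊕ Fin 3) (ℝ ⊗[ℚ] M)) :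
          Matrix (Fin 1 ⊕ Fin 3) (Fin 1 ⊕ Fin 3) (ℝ ⊗[ℚ] M)) *
        P.val.map (Algebra.TensorProduct.includeRight : M →ₐ[ℚ] ℝ ⊗[ℚ] M) =
      P.val.map (Algebra.TensorProduct.includeRight : M →ₐ[ℚ] ℝ ⊗[ℚ] M) * Matrix.diagonal u)
    (y : Fin 1 ⊕ Fin 3 → M) :
    auxComplexStructure F τ Φ T x * (c.actMatrix y).map (algebraMap ℚ ℝ) =
      (c.actMatrix y).map (algebraMap ℚ ℝ) * auxComplexStructure F τ Φ T x := by
  rw [auxComplexStructure_eq_sum_actMatrix F τ Φ T x P c hc u hu, Matrix.sum_mul, Matrix.mul_sum]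
  refine Finset.sum_congr rfl fun p _ => ?_
  rw [Matrix.sum_mul, Matrix.mul_sum]
  refine Finset.sum_congr rfl fun k _ => ?_
  rw [Matrix.smul_mul, Matrix.mul_smul, ← Matrix.map_mul, ← Matrix.map_mul, ← CMStructure.actMatrix_mul,
    ← CMStructure.actMatrix_mul, mul_comm]

/-- Off the block: a simultaneous eigenvector of the `i`-th factor is killed by the other factors (`e_p·e_i = 0`).
[cite: Deligne1971TravauxShimura, 4.18 p. 150] -/
theorem actMatrix_single_mulVec_eq_zero_of_ne (c : CMStructure g δ (Fin 1 ⊕ Fin 3) (fun _ => M))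
    {i p : Fin 1 ⊕ Fin 3} (hpi : p ≠ i) (ρ : M →+* ℂ) (v : Fin g ⊕ Fin g → ℂ)
    (hv : ∀ y : M, (c.actMatrix (Pi.single i y)).map (algebraMap ℚ ℂ) *ᵥ v = ρ y • v) (y : M) :
    (c.actMatrix (Pi.single p y)).map (algebraMap ℚ ℂ) *ᵥ v = 0 := by
  have h1 : v = (c.actMatrix (Pi.single i 1)).map (algebraMap ℚ ℂ) *ᵥ v := by rw [hv 1, map_one, one_smul]
  have h0 : (Pi.single p y : Fin 1 ⊕ Fin 3 → M) * Pi.single i 1 = 0 := by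
    funext q
    rw [Pi.mul_apply, Pi.zero_apply]
    by_cases hq : q = i
    · subst hq
      rw [Pi.single_eq_of_ne (fun h => hpi h.symm), zero_mul]
    · rw [Pi.single_eq_of_ne hq, mul_zero]
  conv_lhs => rw [h1]
  rw [Matrix.mulVec_mulVec, ← Matrix.map_mul, ← CMStructure.actMatrix_mul, h0, CMStructure.actMatrix_def, map_zero,
    map_zero, Matrix.map_zero _ (map_zero _), Matrix.zero_mulVec]

omit [IsCMField M] in
/-- A multiplicative map pulls a scalar out of an entrywise map. [cite: Deligne1971TravauxShimura, 4.18 p. 150] -/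
private theorem smul_map' {S S' : Type} [CommRing S] [CommRing S'] {F' : Type} [FunLike F' S S'] [MulHomClass F' S S']
    {m n : Type} (f : F') (r : S) (A : Matrix m n S) : (r • A).map f = f r • A.map f := by
  ext a b
  simp [map_mul]

/-- **`J_ℂ` on a simultaneous eigenvector of the `i`-th factor with eigencharacter `ρ` is the scalar `ρ̃(u_i)`**, `ρ̃` the
`ℝ`-linear extension of `ρ` read in the basis `1 ⊗ b_k`: `J_ℂ v = (Σ_k u_{i,k} ρ(b_k))·v`. [cite: Deligne1971TravauxShimura, 4.18 p. 150] -/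
theorem auxComplexStructure_map_mulVec_eq (F : SymplecticFrame M j H ξ₀ ξ g δ) (τ : L →+* ℂ)
    (Φ : Literature.AlgebraicGeometry.Motives.CMType M) (T : GL (Fin 3) ℂ) (x : BallModel.Ball)
    (P : GL (Fin 1 ⊕ Fin 3) M) (c : CMStructure g δ (Fin 1 ⊕ Fin 3) (fun _ => M))
    (hc : ∀ (y : Fin 1 ⊕ Fin 3 → M) (p : Fin 1 ⊕ Fin 3) (m : M),
      c.act y (F.β (m • P.val *ᵥ Pi.single p 1)) = F.β ((y p * m) • P.val *ᵥ Pi.single p 1))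
    (u : Fin 1 ⊕ Fin 3 → ℝ ⊗[ℚ] M)
    (hu : ((blockGL (ℝ ⊗[ℚ] M) (iPhi M Φ, sPhi M j Φ τ T x) : GL (Fin 1 ⊕ Fin 3) (ℝ ⊗[ℚ] M)) :
          Matrix (Fin 1 ⊕ Fin 3) (Fin 1 ⊕ Fin 3) (ℝ ⊗[ℚ] M)) *
        P.val.map (Algebra.TensorProduct.includeRight : M →ₐ[ℚ] ℝ ⊗[ℚ] M) =
      P.val.map (Algebra.TensorProduct.includeRight : M →ₐ[ℚ] ℝ ⊗[ℚ] M) * Matrix.diagonal u)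
    (i : Fin 1 ⊕ Fin 3) (ρ : M →+* ℂ) (v : Fin g ⊕ Fin g → ℂ)
    (hv : ∀ y : M, (c.actMatrix (Pi.single i y)).map (algebraMap ℚ ℂ) *ᵥ v = ρ y • v) :
    (auxComplexStructure F τ Φ T x).map (algebraMap ℝ ℂ) *ᵥ v =
      (∑ k : Fin (Module.finrank ℚ M),
        (((Algebra.TensorProduct.basis ℝ (ratBasis M)).repr (u i) k : ℝ) : ℂ) * ρ (ratBasis M k)) • v := by
  have hqc : (algebraMap ℝ ℂ : ℝ → ℂ) ∘ (algebraMap ℚ ℝ : ℚ → ℝ) = (algebraMap ℚ ℂ : ℚ → ℂ) := by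
    funext q
    simp
  rw [auxComplexStructure_eq_sum_actMatrix F τ Φ T x P c hc u hu, ← RingHom.mapMatrix_apply, map_sum,
    Matrix.sum_mulVec, Finset.sum_eq_single i]
  · rw [map_sum, Matrix.sum_mulVec, Finset.sum_smul]
    refine Finset.sum_congr rfl fun k _ => ?_
    rw [RingHom.mapMatrix_apply, smul_map', Matrix.map_map, hqc, Matrix.smul_mulVec, hv, smul_smul]
    rfl
  · intro p _ hpi
    rw [map_sum, Matrix.sum_mulVec]
    refine Finset.sum_eq_zero fun k _ => ?_
    rw [RingHom.mapMatrix_apply, smul_map', Matrix.map_map, hqc, Matrix.smul_mulVec,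
      actMatrix_single_mulVec_eq_zero_of_ne c hpi ρ v hv, smul_zero]
  · intro h
    exact absurd (Finset.mem_univ i) h

omit [IsCMField M] in
/-- The scalar `Σ_k z_k ρ(b_k)` at a `ρ ∈ Φ` is the `ρ`-component `realEmb ρ z`. [cite: Shimura1998, §6.2 Thm. 4, p. 45] -/
theorem sum_repr_mul_eq_realEmb (Φ : Literature.AlgebraicGeometry.Motives.CMType M) (φ : Φ.1) (z : ℝ ⊗[ℚ] M) :
    ∑ k : Fin (Module.finrank ℚ M),
        (((Algebra.TensorProduct.basis ℝ (ratBasis M)).repr z k : ℝ) : ℂ) * φ.1 (ratBasis M k) =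
      realEmb M Φ φ z := by
  conv_rhs => rw [← (Algebra.TensorProduct.basis ℝ (ratBasis M)).sum_repr z]
  rw [map_sum]
  refine Finset.sum_congr rfl fun k _ => ?_
  rw [map_smul, Algebra.TensorProduct.basis_apply, realEmb_tmul, Complex.ofReal_one, one_mul, Complex.real_smul]

omit [IsCMField M] in
/-- The scalar `Σ_k z_k ρ(b_k)` at a `ρ ∉ Φ` is the conjugate of the `ρ̄`-component (`ρ̄ ∈ Φ`). [cite: Shimura1998, §6.2 Thm. 4, p. 45] -/
theorem sum_repr_mul_eq_conj_realEmb (Φ : Literature.AlgebraicGeometry.Motives.CMType M) (ρ : M →+* ℂ)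
    (hρ : ComplexEmbedding.conjugate ρ ∈ Φ.1) (z : ℝ ⊗[ℚ] M) :
    ∑ k : Fin (Module.finrank ℚ M),
        (((Algebra.TensorProduct.basis ℝ (ratBasis M)).repr z k : ℝ) : ℂ) * ρ (ratBasis M k) =
      conj (realEmb M Φ ⟨ComplexEmbedding.conjugate ρ, hρ⟩ z) := by
  rw [← sum_repr_mul_eq_realEmb Φ ⟨ComplexEmbedding.conjugate ρ, hρ⟩ z, map_sum]
  refine Finset.sum_congr rfl fun k _ => ?_
  rw [map_mul, Complex.conj_ofReal, ComplexEmbedding.conjugate_coe_eq, Complex.conj_conj]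

end SpecRead

end Literature.AlgebraicGeometry.ShimuraVarieties.UnitaryCanonicalModel.Aux

end
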